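import Summits.CriticalPhenomena.SAWScalingLimit.Theorems.SAWLoopFugacityFlowSimpleSubseqLimitsLineGlue
import Summits.CriticalPhenomena.SAWScalingLimit.Theorems.SAWLoopFugacityFlowAvoidancePassage
import Summits.CriticalPhenomena.SAWScalingLimit.Theorems.SAWLoopFugacityFlowSLEAvoidanceValue
import HarnessLib

/-!
# `SAWLoopFugacityFlow.LimitAvoidanceValues` (stmt-CriticalPhenomena-18170): the `μ`-free value form
and the weakest sequential A-side input

The support item `LimitAvoidanceValues` says: every subsequential weak limit `ν` of the pushed-forward
critical SAW laws along an endpoint approximation of a Dobrushin domain `(D; a, b)` has the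
hull-avoidance values of SOME chordal SLE_(8/3) law `μ` of `D`,
`ν(range ⊆ cl D') = μ(range ⊆ cl D')` for every inline hull subdomain `D'`.

This helper file (theorems of the tree only, no named fact assumed) records:

* `exists_restrictionData` — every inline hull subdomain `D'` of `D` carries restriction data: a
  chordal uniformizer `φ : ℍ → D` (`MarkedDomain.exists_isChordalUniformizing_holds`), the pulled-back
  `*`-hull `A = φ.pullbackHull D'` (`IsStarHull.pullbackHull`), its restriction map `Φ_A`
  (`IsStarHull.existsUnique_isRestrictionMap_holds`) and derivative `d = Φ_A'(0) ∈ (0, 1]`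
  (`IsStarHull.exists_hasRestrictionDeriv_holds`);
* `value_of_limitAvoidanceValues` / `limitAvoidanceValues_of_values` / `limitAvoidanceValues_iff_values`
  — **the existential over `μ` is inessential**: the item is EQUIVALENT to the `μ`-free statement that
  every subsequential weak limit gives the NUMBER `Φ_A'(0)^{5/8}` to `{range ⊆ cl D'}` for every inline
  hull subdomain `D'` and every choice of restriction data `(φ, A, Φ, d)` (LSW 2003 Thm 6.1 in the tree,
  `SLEAvoidanceValue_proof`; SLE_(8/3) law by `exists_isSLECurve_eightThirds`) — this is the interface a
  sibling route's A-side has to deliver;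
* `limitAvoidanceValues_of_seqAvoidanceLimit` — **the weakest lattice input the passage machinery
  converts into the item**: it suffices that the SAW hull-avoidance probabilities converge to
  `Φ_A'(0)^{5/8}` SEQUENTIALLY and only ALONG sequences `s n → 0⁺` on which the pushed-forward laws
  already converge weakly to a probability measure (so an A-side prover may use the limit `ν`);
  `seqAvoidanceLimit_of_avoidanceLimit` shows the route's A-side crux `AvoidanceLimit`
  (stmt-CriticalPhenomena-10649, full filter `δ → 0⁺`, no weak-limit proviso) is the special case, and
  `limitAvoidanceValues_of_avoidanceLimit'` recovers the landed one-liner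
  `SlitSplit.limitAvoidanceValues_of_avoidanceLimit` through this factorisation.

References: G. F. Lawler, O. Schramm, W. Werner, *Conformal restriction: the chordal case*, J. Amer.
Math. Soc. 16 (2003), Thm. 6.1; *On the scaling limit of planar self-avoiding walk*, Proc. Sympos. Pure
Math. 72 (2004), §4.1, Prediction 1.
-/

noncomputable section

open MeasureTheory Filter Topology Set Metric
open Literature.Probability.RandomPlanarGeometry Literature.Probability.RandomPlanarGeometry.SAW
open Literature.Probability.LatticeModels
open UpperHalfPlane (upperHalfPlaneSet)
open scoped ENNReal NNReal BoundedContinuousFunction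

namespace Summit.CriticalPhenomena.SAWScalingLimit.Theorems.LimitAvoidanceValues

open Summit.CriticalPhenomena.SAWScalingLimit.Theses.SAWLoopFugacityFlow
  (LimitAvoidanceValues AvoidanceLimit)
open Summit.CriticalPhenomena.SAWScalingLimit.Theorems (avoidancePassage_proof SLEAvoidanceValue_proof)
open Summit.CriticalPhenomena.SAWScalingLimit.Theorems.SimpleSubseqLimits.MarkedPointRevisit.Glue
  (notMem_closure_diff_of_ball_eq)

/-! ## Restriction data of an inline hull subdomain exist -/

/-- **Restriction data exist.** For a Dobrushin subdomain `D' ⊆ D` with the same marked points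
agreeing with `D` in balls around them, there are a chordal uniformizer `φ : ℍ → D`, the restriction
map `Φ` of the pulled-back `*`-hull `A = φ.pullbackHull D' = closure (ℍ ∖ φ⁻¹ D')` and its derivative
`d = Φ'(0) ∈ (0, 1]` — all by theorems of the tree (Carathéodory, Jordan–Schoenflies simple
connectivity, LSW §2). [cite: LawlerSchrammWerner2003Restriction, §2 pp. 7–8] -/
theorem exists_restrictionData (D D' : DobrushinDomain) (hsub : D'.carrier ⊆ D.carrier)
    (h0 : D'.pt 0 = D.pt 0) (h1 : D'.pt 1 = D.pt 1)
    (hε : ∃ ε : ℝ, 0 < ε ∧ D'.carrier ∩ ball (D.pt 0) ε = D.carrier ∩ ball (D.pt 0) ε ∧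
      D'.carrier ∩ ball (D.pt 1) ε = D.carrier ∩ ball (D.pt 1) ε) :
    ∃ φ : ConformalEquiv upperHalfPlaneSet D.carrier, D.IsChordalUniformizing φ ∧
      ∃ (Φ : ConformalEquiv (upperHalfPlaneSet \ φ.pullbackHull D') upperHalfPlaneSet) (d : ℝ),
        IsRestrictionMap (φ.pullbackHull D') Φ ∧ HasRestrictionDeriv (φ.pullbackHull D') Φ d ∧
          0 < d ∧ d ≤ 1 := by
  obtain ⟨ε, hεpos, hb0, hb1⟩ := hε
  obtain ⟨φ, hφ⟩ := MarkedDomain.exists_isChordalUniformizing_holds D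
  have hHS : D.IsHullSubdomain D' :=
    ⟨hsub, h0, h1, notMem_closure_diff_of_ball_eq hεpos hb0, notMem_closure_diff_of_ball_eq hεpos hb1⟩
  have hstar : IsStarHull (φ.pullbackHull D') :=
    IsStarHull.pullbackHull JordanDomain.isSimplyConnected_holds hφ hHS
  obtain ⟨Φ, hΦ, -⟩ := IsStarHull.existsUnique_isRestrictionMap_holds hstar
  obtain ⟨d, hd0, hd1, hd⟩ := IsStarHull.exists_hasRestrictionDeriv_holds hstar hΦ
  exact ⟨φ, hφ, Φ, d, hΦ, hd, hd0, hd1⟩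

/-! ## The `μ`-free value form of the item -/

/-- **Values of subsequential limits under the item**: if `LimitAvoidanceValues` holds, every
subsequential weak limit `ν` gives mass `Φ_A'(0)^{5/8}` to `{range ⊆ cl D'}` for every inline hull
subdomain `D'` and every choice of restriction data — the SLE_(8/3) value of LSW Thm 6.1
(`SLEAvoidanceValue_proof`). [cite: LawlerSchrammWerner2003Restriction, Thm 6.1] -/
theorem value_of_limitAvoidanceValues (hV : LimitAvoidanceValues) {D : DobrushinDomain}
    {a b : ℝ → Site 2} (hab : IsEndpointApprox D a b) {s : ℕ → ℝ} {ν : Measure (CurveClass ℂ)}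
    (hs : Tendsto s atTop (𝓝[>] (0 : ℝ))) (hν : IsProbabilityMeasure ν)
    (hw : ∀ f : CurveClass ℂ →ᵇ ℝ,
      Tendsto (fun n => ∫ γ, f γ.curve ∂(SAW.law D.carrier (s n) (a (s n)) (b (s n)))) atTop
        (𝓝 (∫ x, f x ∂ν)))
    {D' : DobrushinDomain} (hsub : D'.carrier ⊆ D.carrier) (h0 : D'.pt 0 = D.pt 0)
    (h1 : D'.pt 1 = D.pt 1)
    (hε : ∃ ε : ℝ, 0 < ε ∧ D'.carrier ∩ ball (D.pt 0) ε = D.carrier ∩ ball (D.pt 0) ε ∧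
      D'.carrier ∩ ball (D.pt 1) ε = D.carrier ∩ ball (D.pt 1) ε)
    (φ : ConformalEquiv upperHalfPlaneSet D.carrier) (hφ : D.IsChordalUniformizing φ)
    (A : Set ℂ) (hA : A = closure (upperHalfPlaneSet \ {z | z ∈ upperHalfPlaneSet ∧ φ z ∈ D'.carrier}))
    (Φ : ConformalEquiv (upperHalfPlaneSet \ A) upperHalfPlaneSet) (d : ℝ)
    (hΦ : IsRestrictionMap A Φ) (hd : HasRestrictionDeriv A Φ d) :
    ν (CurveClass.rangeSubset (closure D'.carrier)) = ENNReal.ofReal (d ^ ((5 : ℝ) / 8)) := by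
  obtain ⟨μ, hμ, hagree⟩ := hV D a b hab s ν hs hν hw
  rw [hagree D' hsub h0 h1 hε]
  exact SLEAvoidanceValue_proof D D' μ hμ hsub h0 h1 hε φ hφ A hA Φ d hΦ hd

/-- **The item from the `μ`-free values**: if every subsequential weak limit gives mass
`Φ_A'(0)^{5/8}` to `{range ⊆ cl D'}` for every inline hull subdomain and every choice of restriction
data, then `LimitAvoidanceValues` holds with `μ` the chordal SLE_(8/3) law
(`exists_isSLECurve_eightThirds`), whose values are the same numbers (`SLEAvoidanceValue_proof`);
restriction data exist by `exists_restrictionData`. [cite: LawlerSchrammWerner2003Restriction, Thm 6.1] -/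
theorem limitAvoidanceValues_of_values
    (h : ∀ (D : DobrushinDomain) (a b : ℝ → Site 2), IsEndpointApprox D a b →
      ∀ (s : ℕ → ℝ) (ν : Measure (CurveClass ℂ)), Tendsto s atTop (𝓝[>] (0 : ℝ)) →
        IsProbabilityMeasure ν →
        (∀ f : CurveClass ℂ →ᵇ ℝ,
          Tendsto (fun n => ∫ γ, f γ.curve ∂(SAW.law D.carrier (s n) (a (s n)) (b (s n)))) atTop
            (𝓝 (∫ x, f x ∂ν))) →
        ∀ D' : DobrushinDomain, D'.carrier ⊆ D.carrier → D'.pt 0 = D.pt 0 → D'.pt 1 = D.pt 1 →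
          (∃ ε : ℝ, 0 < ε ∧ D'.carrier ∩ ball (D.pt 0) ε = D.carrier ∩ ball (D.pt 0) ε ∧
            D'.carrier ∩ ball (D.pt 1) ε = D.carrier ∩ ball (D.pt 1) ε) →
          ∀ (φ : ConformalEquiv upperHalfPlaneSet D.carrier), D.IsChordalUniformizing φ →
            ∀ (A : Set ℂ),
              A = closure (upperHalfPlaneSet \ {z | z ∈ upperHalfPlaneSet ∧ φ z ∈ D'.carrier}) →
              ∀ (Φ : ConformalEquiv (upperHalfPlaneSet \ A) upperHalfPlaneSet) (d : ℝ),
                IsRestrictionMap A Φ → HasRestrictionDeriv A Φ d →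
                  ν (CurveClass.rangeSubset (closure D'.carrier)) =
                    ENNReal.ofReal (d ^ ((5 : ℝ) / 8))) :
    LimitAvoidanceValues := by
  intro D a b hab s ν hs hν hw
  obtain ⟨Γ, hΓ⟩ := exists_isSLECurve_eightThirds D
  refine ⟨_, hΓ.isSLELaw_map, fun D' hsub h0 h1 hε => ?_⟩
  obtain ⟨φ, hφ, Φ, d, hΦ, hd, -, -⟩ := exists_restrictionData D D' hsub h0 h1 hε
  rw [h D a b hab s ν hs hν hw D' hsub h0 h1 hε φ hφ _ rfl Φ d hΦ hd,
    SLEAvoidanceValue_proof D D' _ hΓ.isSLELaw_map hsub h0 h1 hε φ hφ _ rfl Φ d hΦ hd]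

/-- **`μ`-FREE FORM OF THE ITEM.** `LimitAvoidanceValues` is equivalent to: every subsequential weak
limit of the pushed-forward critical SAW laws gives mass `Φ_A'(0)^{5/8}` to `{range ⊆ cl D'}` for every
inline hull subdomain `D'` and every choice of restriction data `(φ, A, Φ, d)`. The existential over the
SLE_(8/3) law in the item is thus inessential: the values are canonical numbers.
[cite: LawlerSchrammWerner2003Restriction, Thm 6.1] -/
theorem limitAvoidanceValues_iff_values :
    LimitAvoidanceValues ↔
      ∀ (D : DobrushinDomain) (a b : ℝ → Site 2), IsEndpointApprox D a b →
        ∀ (s : ℕ → ℝ) (ν : Measure (CurveClass ℂ)), Tendsto s atTop (𝓝[>] (0 : ℝ)) →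
          IsProbabilityMeasure ν →
          (∀ f : CurveClass ℂ →ᵇ ℝ,
            Tendsto (fun n => ∫ γ, f γ.curve ∂(SAW.law D.carrier (s n) (a (s n)) (b (s n)))) atTop
              (𝓝 (∫ x, f x ∂ν))) →
          ∀ D' : DobrushinDomain, D'.carrier ⊆ D.carrier → D'.pt 0 = D.pt 0 → D'.pt 1 = D.pt 1 →
            (∃ ε : ℝ, 0 < ε ∧ D'.carrier ∩ ball (D.pt 0) ε = D.carrier ∩ ball (D.pt 0) ε ∧
              D'.carrier ∩ ball (D.pt 1) ε = D.carrier ∩ ball (D.pt 1) ε) →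
            ∀ (φ : ConformalEquiv upperHalfPlaneSet D.carrier), D.IsChordalUniformizing φ →
              ∀ (A : Set ℂ),
                A = closure (upperHalfPlaneSet \ {z | z ∈ upperHalfPlaneSet ∧ φ z ∈ D'.carrier}) →
                ∀ (Φ : ConformalEquiv (upperHalfPlaneSet \ A) upperHalfPlaneSet) (d : ℝ),
                  IsRestrictionMap A Φ → HasRestrictionDeriv A Φ d →
                    ν (CurveClass.rangeSubset (closure D'.carrier)) =
                      ENNReal.ofReal (d ^ ((5 : ℝ) / 8)) :=
  ⟨fun hV _D _a _b hab _s _ν hs hν hw _D' hsub h0 h1 hε φ hφ A hA Φ d hΦ hd =>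
      value_of_limitAvoidanceValues hV hab hs hν hw hsub h0 h1 hε φ hφ A hA Φ d hΦ hd,
    limitAvoidanceValues_of_values⟩

/-! ## The weakest sequential A-side input -/

/-- **Sequential hull-avoidance limits along weakly convergent sequences suffice.** If, for every
Dobrushin domain, endpoint approximation and EVERY sequence `s n → 0⁺` ALONG WHICH the pushed-forward
critical SAW laws converge weakly to a probability measure, the SAW probabilities of
`{range ⊆ cl D''}` converge to `Φ_A'(0)^{5/8}` for every inline hull subdomain `D''` and every choice
of restriction data, then `LimitAvoidanceValues` holds: the portmanteau sandwich `avoidancePassage_proof`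
(stmt-CriticalPhenomena-4984) turns these sequential limits into the values of the limit measure, and
`SLEAvoidanceValue_proof` (stmt-CriticalPhenomena-10651) identifies them as SLE_(8/3) values.
[cite: LawlerSchrammWerner2004SAW, §4.1 Prediction 1 (conditional identification)] -/
theorem limitAvoidanceValues_of_seqAvoidanceLimit
    (h : ∀ (D : DobrushinDomain) (a b : ℝ → Site 2), IsEndpointApprox D a b →
      ∀ (s : ℕ → ℝ) (ν : Measure (CurveClass ℂ)), Tendsto s atTop (𝓝[>] (0 : ℝ)) →
        IsProbabilityMeasure ν →
        (∀ f : CurveClass ℂ →ᵇ ℝ,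
          Tendsto (fun n => ∫ γ, f γ.curve ∂(SAW.law D.carrier (s n) (a (s n)) (b (s n)))) atTop
            (𝓝 (∫ x, f x ∂ν))) →
        ∀ D' : DobrushinDomain, D'.carrier ⊆ D.carrier → D'.pt 0 = D.pt 0 → D'.pt 1 = D.pt 1 →
          (∃ ε : ℝ, 0 < ε ∧ D'.carrier ∩ ball (D.pt 0) ε = D.carrier ∩ ball (D.pt 0) ε ∧
            D'.carrier ∩ ball (D.pt 1) ε = D.carrier ∩ ball (D.pt 1) ε) →
          ∀ (φ : ConformalEquiv upperHalfPlaneSet D.carrier), D.IsChordalUniformizing φ →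
            ∀ (A : Set ℂ),
              A = closure (upperHalfPlaneSet \ {z | z ∈ upperHalfPlaneSet ∧ φ z ∈ D'.carrier}) →
              ∀ (Φ : ConformalEquiv (upperHalfPlaneSet \ A) upperHalfPlaneSet) (d : ℝ),
                IsRestrictionMap A Φ → HasRestrictionDeriv A Φ d →
                  Tendsto (fun n => ((SAW.law D.carrier (s n) (a (s n)) (b (s n))).map
                      (fun γ => γ.curve)) (CurveClass.rangeSubset (closure D'.carrier))) atTop
                    (𝓝 (ENNReal.ofReal (d ^ ((5 : ℝ) / 8))))) :
    LimitAvoidanceValues := by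
  intro D a b hab s ν hs hν hw
  obtain ⟨Γ, hΓ⟩ := exists_isSLECurve_eightThirds D
  refine ⟨_, hΓ.isSLELaw_map, fun D' hsub h0 h1 hε => ?_⟩
  refine avoidancePassage_proof D a b hab s ν _ hs hν hw hΓ.isSLELaw_map ?_ D' hsub h0 h1 hε
  intro D'' hsub'' h0'' h1'' hε''
  obtain ⟨φ, hφ, Φ, d, hΦ, hd, -, -⟩ := exists_restrictionData D D'' hsub'' h0'' h1'' hε''
  rw [SLEAvoidanceValue_proof D D'' _ hΓ.isSLELaw_map hsub'' h0'' h1'' hε'' φ hφ _ rfl Φ d hΦ hd]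
  exact h D a b hab s ν hs hν hw D'' hsub'' h0'' h1'' hε'' φ hφ _ rfl Φ d hΦ hd

/-- **`AvoidanceLimit` is the special case**: the route's A-side crux (stmt-CriticalPhenomena-10649,
hull-avoidance limits along the full filter `δ → 0⁺`) gives the sequential input of
`limitAvoidanceValues_of_seqAvoidanceLimit` along every sequence `s n → 0⁺`, weakly convergent or
not. [folklore] -/
theorem seqAvoidanceLimit_of_avoidanceLimit (hA : AvoidanceLimit) :
    ∀ (D : DobrushinDomain) (a b : ℝ → Site 2), IsEndpointApprox D a b →
      ∀ (s : ℕ → ℝ) (ν : Measure (CurveClass ℂ)), Tendsto s atTop (𝓝[>] (0 : ℝ)) →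
        IsProbabilityMeasure ν →
        (∀ f : CurveClass ℂ →ᵇ ℝ,
          Tendsto (fun n => ∫ γ, f γ.curve ∂(SAW.law D.carrier (s n) (a (s n)) (b (s n)))) atTop
            (𝓝 (∫ x, f x ∂ν))) →
        ∀ D' : DobrushinDomain, D'.carrier ⊆ D.carrier → D'.pt 0 = D.pt 0 → D'.pt 1 = D.pt 1 →
          (∃ ε : ℝ, 0 < ε ∧ D'.carrier ∩ ball (D.pt 0) ε = D.carrier ∩ ball (D.pt 0) ε ∧
            D'.carrier ∩ ball (D.pt 1) ε = D.carrier ∩ ball (D.pt 1) ε) →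
          ∀ (φ : ConformalEquiv upperHalfPlaneSet D.carrier), D.IsChordalUniformizing φ →
            ∀ (A : Set ℂ),
              A = closure (upperHalfPlaneSet \ {z | z ∈ upperHalfPlaneSet ∧ φ z ∈ D'.carrier}) →
              ∀ (Φ : ConformalEquiv (upperHalfPlaneSet \ A) upperHalfPlaneSet) (d : ℝ),
                IsRestrictionMap A Φ → HasRestrictionDeriv A Φ d →
                  Tendsto (fun n => ((SAW.law D.carrier (s n) (a (s n)) (b (s n))).map
                      (fun γ => γ.curve)) (CurveClass.rangeSubset (closure D'.carrier))) atTop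
                    (𝓝 (ENNReal.ofReal (d ^ ((5 : ℝ) / 8)))) :=
  fun D a b hab _s _ν hs _hν _hw D' hsub h0 h1 hε φ hφ A hAeq Φ d hΦ hd =>
    (hA D D' a b hab hsub h0 h1 hε φ hφ A hAeq Φ d hΦ hd).comp hs

/-- **The landed one-liner, through the factorisation**: `AvoidanceLimit → LimitAvoidanceValues`
(= `SlitSplit.limitAvoidanceValues_of_avoidanceLimit`, here as
`limitAvoidanceValues_of_seqAvoidanceLimit ∘ seqAvoidanceLimit_of_avoidanceLimit`). [folklore] -/
theorem limitAvoidanceValues_of_avoidanceLimit' (hA : AvoidanceLimit) : LimitAvoidanceValues :=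
  limitAvoidanceValues_of_seqAvoidanceLimit (seqAvoidanceLimit_of_avoidanceLimit hA)

end Summit.CriticalPhenomena.SAWScalingLimit.Theorems.LimitAvoidanceValues

end
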